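import Summits.BirchSwinnertonDyer.Rank1Residual.X10.ResidualSelmerCompanions
import Summits.BirchSwinnertonDyer.Rank1Residual.X1.CongruenceTransfer
import HarnessLib

/-!
# `S⁰` TRANSFER FROM A TAMAGAWA-FREE PARTNER, row-check form: `#S⁰(E) = #Sel_p(A)` from a kernel
# congruence `TorsionIso A E p`, two integral models and ONE Tate-algorithm row check on the partner
# (cell `b2b-bsdres`, unit `b2b-bsdres-x10` = N2 class lead, GEN 32; TOOL — theorems only, no definition,
# ONE named-fact hypothesis `hMR` = Mazur–Rubin 2015 Thm. 3.1 (iv)(b); nothing booked)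

HONEST FRAMING (run/shared/lean/b2b/bsd-rank1-residual/, verbatim in every file): the goal of the
cell is to DELETE the COMBINATION-SHAPED residual classes of the Birch–Swinnerton-Dyer formula for
ALL analytic-rank `≤ 1` elliptic curves over `ℚ` — "full BSD formula for every rank `≤ 1` curve in
class `C`" assembled STRICTLY from published theorems — so that the rank-`≤ 1` remainder becomes
exactly the CONSTRUCTION-SHAPED classes, which are TYPED (missing-input `Prop`s), NOT attempted.
This is not "finishing BSD". Class X10b (= N2) keeps its label CONSTRUCTION-SHAPED (NEEDS `X_A3`,
referee R82.3 / RESIDUAL-MAP §I N2); this file is a TOOL; no mark / label / tier / count moves.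

## What

`X10/ResidualSelmerCompanions.natCard_selmerGroup_eq_natCard_residualSelmerGroup_of_congr` (x10 GEN 32:
`#Sel_p(A) = #S⁰(E)` for a Tamagawa-`p`-free `A` `p`-congruent to `E`, both good above `p`; `hMR`) in
the RECORD currency of the K-CM road: the congruence as the tree's `TorsionIso A W p` (the `Prop`
produced by x10 GEN 23's Hesse / dual-Hesse KERNEL certificates `torsionIso_cm<A>_t<E>`,
`X10/CMPartnerThetaFreeRecords*`), good reduction at `p` of both curves from `p ∤ Δ` of their integral
models (`hasGoodReductionAt_of_map_eq_of_not_dvd`), `p ∤ ∏ c_ℓ(A)` from a stage-1 Tate-algorithm row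
certificate of `A`'s integral model all of whose certified local value sets are prime to `p`
(`IntModelTam.not_dvd_tamagawaProduct_of_intModel_of_rowCheck`). Results:
`natCard_residualSelmerGroup_eq_of_torsionIso` (**`#S⁰(E) = #Sel_p(A)`**),
`residualSelmerGroup_eq_bot_iff_of_torsionIso` (`S⁰(E) = ⊥ ↔ #Sel_p(A) = 1`),
`residualSelmerGroup_ne_bot_of_torsionIso` (`#Sel_p(A) ≠ 1 ⟹ S⁰(E) ≠ ⊥` — PT-free road to the parity
records' conclusion through the partner's Selmer census). Records: `X10/ResidualSelmerCMTransferRecords*`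
(the 94 K-CM cells). CONDITIONAL on `hMR` only; nothing booked.

References: [MazurRubin2007] Def. 1.2, Thm. 1.4; [MazurRubin2015SelmerCompanions] Thm. 3.1 (iv)(b);
[SilvermanAEC2009] VII.5 Prop. 5.1 (a); [SilvermanATAEC1994] IV.9.4; HOME/X10-AUDIT.md §38.
-/

set_option autoImplicit false

noncomputable section

open scoped Classical

open WeierstrassCurve Literature.NumberTheory.EllipticCurves Literature.NumberTheory.GaloisRepresentations
  Literature.NumberTheory.GaloisCohomology NumberField IsDedekindDomain Field
open Literature.NumberTheory.EllipticCurves.MazurRubin2015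
open Summit.BirchSwinnertonDyer.BirchSwinnertonDyer.Rank2Observatory.Tam
open Summit.BirchSwinnertonDyer.Rank1Residual.Additive
open Summit.BirchSwinnertonDyer.Rank1Residual.X1.CongruenceTransfer (TorsionIso)
open Summit.BirchSwinnertonDyer.Rank1Residual.X10.SelmerCompanionsTamagawaFree
open Summit.BirchSwinnertonDyer.Rank1Residual.X10.ResidualSelmerGroup
open Summit.BirchSwinnertonDyer.Rank1Residual.X10.ResidualSelmerCompanions

namespace Summit.BirchSwinnertonDyer.Rank1Residual.X10.ResidualSelmerCMTransfer

variable (p : ℕ) [hp : Fact p.Prime]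

/-- **`#S⁰(E) = #Sel_p(A)` from a kernel congruence and two integral models.** `p` odd;
`W = E`, `A` over `ℚ`, globally minimal with integral models `EW`, `EA`, both with `p ∤ Δ` (good at
`p`); `Es` a stage-1 Tate-algorithm row certificate of `EA` with every certified local value set prime to
`p` (`p ∤ ∏ c_ℓ(A)`); `TorsionIso A W p` (a `Γ_ℚ`-isomorphism `A[p] ⥲ E[p]`). Then
`#S⁰(E) = #S⁰(A) = #Sel_p(A)`. CONDITIONAL on `hMR`.
[cite: MazurRubin2007, Def. 1.2 and Thm. 1.4] [cite: MazurRubin2015SelmerCompanions, Thm. 3.1 (iv)(b)]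
[cite: SilvermanATAEC1994, IV.9.4] -/
theorem natCard_residualSelmerGroup_eq_of_torsionIso (hMR : selmerLocalKer_iff_of_goodReduction_above)
    (hp2 : p ≠ 2) (W A : WeierstrassCurve ℚ) [W.IsElliptic] [W.IsGloballyMinimal] [A.IsElliptic]
    [A.IsGloballyMinimal] {EW EA : WeierstrassCurve ℤ} (hIW : integralModelInt W = EW)
    (hIA : integralModelInt A = EA) (hΔW : ¬ (p : ℤ) ∣ EW.Δ) (hΔA : ¬ (p : ℤ) ∣ EA.Δ)
    {Es : List TamLocal} (hrow : TamLocal.rowCheck Es EA = true)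
    (hvals : (TamLocal.rowVals Es).all (fun c => !decide (p ∣ c)) = true) (hθ : TorsionIso A W p) :
    Nat.card (residualSelmerGroup W p) = Nat.card (A.selmerGroup (p : ℤ)) := by
  obtain ⟨θ, hθ'⟩ := hθ
  exact (natCard_selmerGroup_eq_natCard_residualSelmerGroup_of_congr W A p hMR hp2 θ hθ'
    (fun v hv ↦ ⟨hasGoodReductionAt_of_map_eq_of_not_dvd (p := p) W (hIW ▸ map_integralModelInt W) hΔW v hv,
      hasGoodReductionAt_of_map_eq_of_not_dvd (p := p) A (hIA ▸ map_integralModelInt A) hΔA v hv⟩)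
    (IntModelTam.not_dvd_tamagawaProduct_of_intModel_of_rowCheck hIA hrow p hvals)).symm

/-- **`S⁰(E) = ⊥ ↔ #Sel_p(A) = 1`** under the same data (a UNIT partner ⟺ `S⁰(E) = 0`). CONDITIONAL on
`hMR`. [cite: MazurRubin2007, Thm. 1.4] [cite: MazurRubin2015SelmerCompanions, Thm. 3.1 (iv)(b)] -/
theorem residualSelmerGroup_eq_bot_iff_of_torsionIso (hMR : selmerLocalKer_iff_of_goodReduction_above)
    (hp2 : p ≠ 2) (W A : WeierstrassCurve ℚ) [W.IsElliptic] [W.IsGloballyMinimal] [A.IsElliptic]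
    [A.IsGloballyMinimal] {EW EA : WeierstrassCurve ℤ} (hIW : integralModelInt W = EW)
    (hIA : integralModelInt A = EA) (hΔW : ¬ (p : ℤ) ∣ EW.Δ) (hΔA : ¬ (p : ℤ) ∣ EA.Δ)
    {Es : List TamLocal} (hrow : TamLocal.rowCheck Es EA = true)
    (hvals : (TamLocal.rowVals Es).all (fun c => !decide (p ∣ c)) = true) (hθ : TorsionIso A W p) :
    residualSelmerGroup W p = ⊥ ↔ Nat.card (A.selmerGroup (p : ℤ)) = 1 := by
  rw [← natCard_residualSelmerGroup_eq_of_torsionIso p hMR hp2 W A hIW hIA hΔW hΔA hrow hvals hθ]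
  exact ⟨fun h => by rw [h, AddSubgroup.card_bot], fun h => AddSubgroup.eq_bot_of_card_eq _ h⟩

/-- **`#Sel_p(A) ≠ 1 ⟹ S⁰(E) ≠ ⊥`** under the same data — the PT-free road to the conclusion of the
parity records through the partner's Selmer census. CONDITIONAL on `hMR`.
[cite: MazurRubin2007, Thm. 1.4] [cite: MazurRubin2015SelmerCompanions, Thm. 3.1 (iv)(b)] -/
theorem residualSelmerGroup_ne_bot_of_torsionIso (hMR : selmerLocalKer_iff_of_goodReduction_above)
    (hp2 : p ≠ 2) (W A : WeierstrassCurve ℚ) [W.IsElliptic] [W.IsGloballyMinimal] [A.IsElliptic]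
    [A.IsGloballyMinimal] {EW EA : WeierstrassCurve ℤ} (hIW : integralModelInt W = EW)
    (hIA : integralModelInt A = EA) (hΔW : ¬ (p : ℤ) ∣ EW.Δ) (hΔA : ¬ (p : ℤ) ∣ EA.Δ)
    {Es : List TamLocal} (hrow : TamLocal.rowCheck Es EA = true)
    (hvals : (TamLocal.rowVals Es).all (fun c => !decide (p ∣ c)) = true) (hθ : TorsionIso A W p)
    (hSelA : Nat.card (A.selmerGroup (p : ℤ)) ≠ 1) : residualSelmerGroup W p ≠ ⊥ := fun h =>
  hSelA ((residualSelmerGroup_eq_bot_iff_of_torsionIso p hMR hp2 W A hIW hIA hΔW hΔA hrow hvals hθ).mp h)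

end Summit.BirchSwinnertonDyer.Rank1Residual.X10.ResidualSelmerCMTransfer

end
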